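import Literature.AlgebraicGeometry.AbelianSchemes.AbelianSchemeOverBase
import Literature.AlgebraicGeometry.AbelianSchemes.AbelianSchemeOverField
import Literature.AlgebraicGeometry.Motives.AbelianVarietyConjugate
import Literature.AlgebraicGeometry.Limits.SliceBaseChange
import HarnessLib

/-!
# The fibre of an abelian scheme at a `σ`-twisted point is the `σ`-conjugate of the fibre
# (Görtz–Wedhorn I §(4.7) Prop. 4.16; Milne, *Shimura varieties* §11 «`σA`», §14 «`σ(A, s, ηK)`»)

Cell `hodgecm-mathlib`, M1PRIME-DAG rung 0, the «`Spec σ` CONJUGATE JUNCTION» of the W3 layer (B-p13 (g13) assembly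
interface 2026-08-29 00:16:36Z item (5)): for the moduli interpretation `IsModuli` one reads the action of `σ ∈ Aut(ℂ)`
on `ℂ`-points of the fine moduli scheme, `P ↦ Spec σ ≫ P`, on the classified abelian variety; the classified object
at the twisted point is the pull-back along `Spec σ ≫ s`, and this file identifies its fibre with Milne's conjugate
`σA` of the fibre at `s` ([Milne2005ShimuraVarieties, §14 pp. 124–125]: «`σ(A, s, ηK) = (σA, σs, σηK)`»).

For an abelian scheme `A → S` (`AbelianSchemeOver`, MFK Def. 6.1), a field-valued point `s : Spec L → S` and a
ring automorphism `σ` of `L`, with `Spec σ : Spec L → Spec L`: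

* `conjFibreGrpIso`, `conjFibreIso A σ s : ((A.fibre s).toAbelianVariety).conjugate σ ≅
  (A.fibre (Spec σ ≫ s)).toAbelianVariety` — an isomorphism of ABELIAN VARIETIES over `L` (group structures
  included): transitivity of base change `(A ×_S Spec L) ×_{Spec L, Spec σ} Spec L ≅ A ×_{S, Spec σ ≫ s} Spec L`
  ([GortzWedhorn2020, Prop. 4.16]) in the form WITH EXPLICIT PROJECTIONS (★ `Limits.pullbackFacIso`), which is
  monoidal for the cartesian structures and therefore lifts to group objects (Mathlib `Functor.mapGrpNatIso`,
  `Functor.mapGrpCompIso`; the pattern of ★ `AbelianVariety.baseChangeTowerIso` and ★ `AbelianScheme.fibreFacIso`).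
  Here `conjugate σ` is the tree's `Motives.AbelianVariety.conjugate` = base change along `Spec σ` itself
  (`baseChangeAlong σ.toRingHom`), the side on which `σ • x = Spec σ ≫ x`;
* `conjFibreIso_hom_hom_hom_hom` — its underlying `L`-morphism is `Limits.pullbackFacObjIso … A.X` (by `rfl`);
* `map_conjFibreIso_conjPoints_left_fst` / `_snd` — projection formulas: the image of a conjugate point `x^σ`
  (★ `AbelianVariety.conjPoints`) lies over `Spec σ ≫ x ≫ pr_A` and is an `L`-point;
* `map_conjFibreIso_conjPoints_restrictPt` — **the section junction**: for a section `τ` of `A → S`,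
  `e((τ(s))^σ) = τ(Spec σ ≫ s)` in the tree's `restrictPt` currency (MFK Def. 7.1 «the images `σᵢ(s)`»), i.e. the
  conjugate of the level structure read at `s` IS the level structure read at the twisted point.

Definitions with bodies (the two isomorphisms, one abbreviation) and theorems; no named fact, no instance, no
`sorry`.  HC_CM is proved only modulo the 7 printed citations until rung 0 closes; nothing here discharges a binder.

## References
* [GortzWedhorn2020] U. Görtz, T. Wedhorn, *Algebraic Geometry I*, 2nd ed. (2020), §(4.7) and Prop. 4.16
  (transitivity of base change), Remark 16.54 (base change of abelian schemes).
* [Milne2005ShimuraVarieties] J. S. Milne, *Introduction to Shimura varieties* (2005/2017), §11 p. 108 («`σA`»,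
  «`σP ∈ σA(Ω)`»), §14 pp. 124–125 («`σ(A, s, ηK) = (σA, σs, σηK)`»).
* [MumfordFogartyKirwan1994] D. Mumford, J. Fogarty, F. Kirwan, *Geometric Invariant Theory*, 3rd ed., Ch. 6 §1
  Def. 6.1 (p. 115), Ch. 7 §1 Def. 7.1 (p. 129).
-/

noncomputable section

universe u

open CategoryTheory CategoryTheory.Limits AlgebraicGeometry

namespace Literature.AlgebraicGeometry.AbelianSchemes

namespace AbelianSchemeOver

open Literature.AlgebraicGeometry.Motives Literature.AlgebraicGeometry.Limits
open scoped MonObj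

set_option backward.isDefEq.respectTransparency false

variable {S : Scheme.{u}} (A : AbelianSchemeOver S) {L : Type u} [Field L] (σ : L ≃+* L)
  (s : Spec (.of L) ⟶ S)

/-- `Spec σ : Spec L ⟶ Spec L` for a ring automorphism `σ` of `L` — the morphism along which the tree's
`AbelianVariety.conjugate σ` base-changes (`baseChangeAlong σ.toRingHom`; Milne's «extension of the base field»
along `σ : k → Ω`). [cite: Milne2005ShimuraVarieties, §11 p. 108] -/
abbrev specTwist : Spec (.of L) ⟶ Spec (.of L) :=
  Spec.map (CommRingCat.ofHom σ.toRingHom)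

/-- The twisted fibre's group `L`-scheme is `Over.pullback (Spec σ ≫ s)` applied to the group `S`-scheme of `A`
(by construction of `fibre`/`baseChange`: `Functor.grpObjObj`). [cite: GortzWedhorn2020, Section (4.7) and Remark 16.54] -/
theorem toGrp_toAbelianVariety_fibre_specTwist :
    ((A.fibre (specTwist σ ≫ s)).toAbelianVariety).toGrp = (Over.pullback (specTwist σ ≫ s)).mapGrp.obj A.toGrp :=
  rfl

/-- The conjugate fibre's group `L`-scheme is `Over.pullback (Spec σ)` applied to `Over.pullback s` applied to the
group `S`-scheme of `A` (★ `AbelianVariety.conjugate` = `baseChangeAlong σ.toRingHom`, by construction).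
[cite: Milne2005ShimuraVarieties, §11 p. 108] [cite: GortzWedhorn2020, Section (4.7)] -/
theorem toGrp_conjugate_toAbelianVariety_fibre :
    (((A.fibre s).toAbelianVariety).conjugate σ).toGrp =
      ((Over.pullback s).mapGrp ⋙ (Over.pullback (specTwist σ)).mapGrp).obj A.toGrp :=
  rfl

/-- **`(A_s)^σ ≅ A_{Spec σ ≫ s}` on GROUP `L`-schemes**: the transitivity isomorphism with explicit projections
`Over.pullback s ⋙ Over.pullback (Spec σ) ≅ Over.pullback (Spec σ ≫ s)` (★ `Limits.pullbackFacIso`) is monoidal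
for the cartesian structures, hence lifts to group objects (Mathlib `Functor.mapGrpNatIso`, `Functor.mapGrpCompIso`).
[cite: GortzWedhorn2020, Section (4.7), Prop. 4.16 and Remark 16.54] -/
def conjFibreGrpIso :
    (((A.fibre s).toAbelianVariety).conjugate σ).toGrp ≅ ((A.fibre (specTwist σ ≫ s)).toAbelianVariety).toGrp :=
  (Functor.mapGrpCompIso.symm ≪≫
      Functor.mapGrpNatIso (pullbackFacIso s (specTwist σ) (specTwist σ ≫ s) rfl)).app A.toGrp

/-- **The fibre at the `σ`-twisted point is the `σ`-conjugate of the fibre**, as ABELIAN VARIETIES over `L`: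
`(A_s)^σ = (A ×_S Spec L) ×_{Spec L, Spec σ} Spec L ≅ A ×_{S, Spec σ ≫ s} Spec L = A_{Spec σ ≫ s}`
([GortzWedhorn2020, Prop. 4.16] transitivity of base change; Milne's «`σA`» for `A = A_s`).
[cite: GortzWedhorn2020, Section (4.7), Prop. 4.16] [cite: Milne2005ShimuraVarieties, §11 p. 108 and §14 pp. 124–125] -/
def conjFibreIso :
    ((A.fibre s).toAbelianVariety).conjugate σ ≅ (A.fibre (specTwist σ ≫ s)).toAbelianVariety :=
  InducedCategory.isoMk (X := ((A.fibre s).toAbelianVariety).conjugate σ)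
    (Y := (A.fibre (specTwist σ ≫ s)).toAbelianVariety) (A.conjFibreGrpIso σ s)

/-- The underlying `L`-morphism of `conjFibreIso` is the transitivity isomorphism `Limits.pullbackFacObjIso` at
the total space `A.X` (by `rfl`). [cite: GortzWedhorn2020, Section (4.7), Prop. 4.16] -/
theorem conjFibreIso_hom_hom_hom_hom :
    (A.conjFibreIso σ s).hom.hom.hom.hom =
      (pullbackFacObjIso s (specTwist σ) (specTwist σ ≫ s) rfl A.X).hom :=
  rfl

/-- The same for the inverse. [cite: GortzWedhorn2020, Section (4.7), Prop. 4.16] -/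
theorem conjFibreIso_inv_hom_hom_hom :
    (A.conjFibreIso σ s).inv.hom.hom.hom =
      (pullbackFacObjIso s (specTwist σ) (specTwist σ ≫ s) rfl A.X).inv :=
  rfl

/-- **First projection of the transported conjugate point**: for an `L`-point `x` of the fibre `A_s`, the image under
`conjFibreIso` of the conjugate point `x^σ` (★ `AbelianVariety.conjPoints`) lies over `Spec σ ≫ x ≫ pr_A` in the total
space `A` (★ `conjPoints_left_comp_fst`: «`x^σ` lies over `Spec σ ≫ x`»). [cite: Milne2005ShimuraVarieties, §11 p. 108 («σP ∈ σA(Ω)»)] -/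
theorem map_conjFibreIso_conjPoints_left_fst (P : (A.fibre s).toAbelianVariety.Points L) :
    (AlgPoints.map (A.conjFibreIso σ s).hom.hom.hom.hom ((A.fibre s).toAbelianVariety.conjPoints σ P)).left ≫
        pullback.fst A.X.hom (specTwist σ ≫ s) =
      specTwist σ ≫ P.left ≫ pullback.fst A.X.hom s := by
  have h1 := pullbackFacObjIso_hom_left_fst s (specTwist σ) (specTwist σ ≫ s) rfl A.X
  have h2 := AbelianVariety.conjPoints_left_comp_fst σ (A := (A.fibre s).toAbelianVariety) P
  rw [AlgPoints.map_apply, Over.comp_left, conjFibreIso_hom_hom_hom_hom, Category.assoc]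
  erw [h1]
  rw [← Category.assoc]
  erw [h2]
  rw [Category.assoc]

/-- **Second projection**: the transported conjugate point is an `L`-point of the twisted fibre (its structure map to
`Spec L` is the identity). [cite: Milne2005ShimuraVarieties, §11 p. 108 («σP ∈ σA(Ω)»)] -/
theorem map_conjFibreIso_conjPoints_left_snd (P : (A.fibre s).toAbelianVariety.Points L) :
    (AlgPoints.map (A.conjFibreIso σ s).hom.hom.hom.hom ((A.fibre s).toAbelianVariety.conjPoints σ P)).left ≫
        pullback.snd A.X.hom (specTwist σ ≫ s) = 𝟙 _ := by
  have h1 := pullbackFacObjIso_hom_left_snd s (specTwist σ) (specTwist σ ≫ s) rfl A.X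
  have h := Over.w ((A.fibre s).toAbelianVariety.conjPoints σ P)
  rw [AlgPoints.map_apply, Over.comp_left, conjFibreIso_hom_hom_hom_hom, Category.assoc]
  erw [h1, h]
  change Spec.map (CommRingCat.ofHom (algebraMap L L)) = _
  rw [Algebra.algebraMap_self, CommRingCat.ofHom_id, Spec.map_id]
  rfl

/-- **The section junction: `e((τ(s))^σ) = τ(Spec σ ≫ s)`.**  For a section `τ` of `A → S`, the conjugate of its
value at `s` (an `L`-point of `(A_s)^σ`, ★ `conjPoints`) is carried by `conjFibreIso` to its value at the twisted
point `Spec σ ≫ s` (both in the tree's `restrictPt` currency, MFK Def. 7.1 «the images `σᵢ(s)`»).  In the moduli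
interpretation this is Milne's «`σ(A, s, ηK) = (σA, σs, σηK)`» read on the level sections.
[cite: MumfordFogartyKirwan1994, Ch. 7 §1 Definition 7.1 (p. 129)] [cite: Milne2005ShimuraVarieties, §14 pp. 124–125] -/
theorem map_conjFibreIso_conjPoints_restrictPt (τ : A.Sections) :
    AlgPoints.map (A.conjFibreIso σ s).hom.hom.hom.hom
        ((A.fibre s).toAbelianVariety.conjPoints σ (A.restrictPt s τ)) =
      A.restrictPt (specTwist σ ≫ s) τ := by
  apply Over.OverMorphism.ext
  apply pullback.hom_ext
  · erw [map_conjFibreIso_conjPoints_left_fst, restrictPt_left_fst, restrictPt_left_fst]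
    rw [Category.assoc]
  · erw [map_conjFibreIso_conjPoints_left_snd, restrictPt_left_snd]

/-- **Def-free packaging for consumers** (W3 junction): there is an isomorphism of abelian varieties over `L` between
the `σ`-conjugate of the fibre at `s` and the fibre at `Spec σ ≫ s` carrying, for every section `τ` of `A → S`, the
conjugate point `(τ(s))^σ` to `τ(Spec σ ≫ s)`. [cite: GortzWedhorn2020, Section (4.7), Prop. 4.16]
[cite: Milne2005ShimuraVarieties, §14 pp. 124–125] -/
theorem exists_iso_conjugate_fibre_map_conjPoints_restrictPt :
    ∃ e : ((A.fibre s).toAbelianVariety).conjugate σ ≅ (A.fibre (specTwist σ ≫ s)).toAbelianVariety,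
      ∀ τ : A.Sections, AlgPoints.map e.hom.hom.hom.hom
          ((A.fibre s).toAbelianVariety.conjPoints σ (A.restrictPt s τ)) = A.restrictPt (specTwist σ ≫ s) τ :=
  ⟨A.conjFibreIso σ s, A.map_conjFibreIso_conjPoints_restrictPt σ s⟩

end AbelianSchemeOver

end Literature.AlgebraicGeometry.AbelianSchemes

end
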